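import Summits.ValiantsHypothesis.ValiantsHypothesis.Theorems.MatrixDescartes.Negative.MatrixDescartesFalseOfTropicalMonster

/-!
# Crux `MatrixDescartes` (stmt-ValiantsHypothesis-18050), line `Lift` — registered stub `stub_dominantInjective`

In a tropical design (exponents `d`, valuations `v`, signs `ε`) the Leibniz terms `p = (σ, λ)` have
the tropical weight `tropWeight d v θ p = θ · S(p) − V(p)`, AFFINE in the integer slope `θ`, and
`IsDominant d v ε θ p` says that `p` is the UNIQUE optimum at `θ` among the present terms
(`termSign ε · ≠ 0`).  The stub: `B + 1` dominant terms `p 0, …, p B` at strictly increasing slopes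
`θ 0 < ⋯ < θ B` with alternating signs `termSign (p k) · termSign (p (k+1)) < 0` are pairwise distinct,
i.e. `p` is injective.

Proof.  Let `a < b` with `p a = p b` and put `c := a + 1 ≤ b`.
* If `p c = p a`, the alternation at the index `a` reads `termSign (p a) · termSign (p a) < 0`,
  contradicting `mul_self_nonneg`.
* Otherwise `a < c < b` (as `p b = p a ≠ p c`).  Dominance of `p a` at `θ a` and of `p b = p a` at
  `θ b` gives `D(θ a) > 0` and `D(θ b) > 0` for the affine function
  `D(θ) := tropWeight θ (p a) − tropWeight θ (p c) = θ · (S(p a) − S(p c)) − (V(p a) − V(p c))`;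
  an affine function positive at both ends of `[θ a, θ b]` is positive at `θ c` in between
  (`StubDominantInjective.affine_lt_between`: compare with the left end if the slope is `≥ 0`, with
  the right end otherwise), whereas dominance of `p c` at `θ c` says `D(θ c) < 0`.
Injectivity follows by trichotomy of the two indices.

Elementary; Mathlib + the tree definitions `tropWeight`, `termSign`, `IsDominant` of
`Theorems/MatrixDescartes/Negative/MatrixDescartesFalseOfTropicalMonster` (axioms `propext`,
`Classical.choice`, `Quot.sound`).
-/

-- layout Summits/ValiantsHypothesis/ValiantsHypothesis forces the duplicated namespace component
set_option linter.dupNamespace false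

namespace Summit.ValiantsHypothesis.ValiantsHypothesis.Theorems.LacunarySymmetroidMatrixDescartes

open Summit.ValiantsHypothesis.ValiantsHypothesis.Theorems.MatrixDescartes.Negative

namespace StubDominantInjective

/-- An affine function `θ ↦ θ · (Sp − Sq) − (Vp − Vq)` of an ordered ring that is positive at `θa`
and at `θb` is positive at every `θc ∈ [θa, θb]` (written as the comparison of the two affine
functions `θ · Sq − Vq < θ · Sp − Vp`). -/
theorem affine_lt_between {Sp Sq Vp Vq θa θb θc : ℤ} (hac : θa ≤ θc) (hcb : θc ≤ θb)
    (ha : θa * Sq - Vq < θa * Sp - Vp) (hb : θb * Sq - Vq < θb * Sp - Vp) :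
    θc * Sq - Vq < θc * Sp - Vp := by
  rcases le_or_gt Sq Sp with hS | hS
  · -- nonnegative slope: compare with the left end point
    have h : θa * (Sp - Sq) ≤ θc * (Sp - Sq) := mul_le_mul_of_nonneg_right hac (sub_nonneg.mpr hS)
    linarith
  · -- negative slope: compare with the right end point
    have h : θb * (Sp - Sq) ≤ θc * (Sp - Sq) :=
      mul_le_mul_of_nonpos_right hcb (sub_nonpos.mpr hS.le)
    linarith

variable {m K : ℕ}

/-- Tropical weights are affine in the slope: if the term `p` beats the term `q` at the slopes
`θa ≤ θb`, it beats `q` at every slope `θc` in between. -/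
theorem tropWeight_lt_between (d : Fin K → ℕ) (v : Fin m → Fin m → Fin K → ℤ)
    (p q : Equiv.Perm (Fin m) × (Fin m → Fin K)) {θa θb θc : ℤ} (hac : θa ≤ θc) (hcb : θc ≤ θb)
    (ha : tropWeight d v θa q < tropWeight d v θa p)
    (hb : tropWeight d v θb q < tropWeight d v θb p) :
    tropWeight d v θc q < tropWeight d v θc p := by
  unfold tropWeight at ha hb ⊢
  exact affine_lt_between hac hcb ha hb

/-- The heart of the stub: under strictly increasing slopes, dominance and sign alternation, no
Leibniz term occurs at two indices `a < b`. -/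
theorem apart (d : Fin K → ℕ) (v ε : Fin m → Fin m → Fin K → ℤ) {B : ℕ}
    (θ : Fin (B + 1) → ℤ) (p : Fin (B + 1) → Equiv.Perm (Fin m) × (Fin m → Fin K))
    (hθ : StrictMono θ) (hdom : ∀ k, IsDominant d v ε (θ k) (p k))
    (halt : ∀ k : Fin B, termSign ε (p k.castSucc) * termSign ε (p k.succ) < 0)
    {a b : Fin (B + 1)} (hab : a < b) : p a ≠ p b := by
  intro hpab
  have hab' : (a : ℕ) < (b : ℕ) := Fin.lt_def.1 hab
  have haB : (a : ℕ) < B := by have := b.isLt; omega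
  -- the square of the (integer) sign of a term is not negative
  have hsq : ¬ termSign ε (p a) * termSign ε (p a) < 0 := not_lt.mpr (mul_self_nonneg _)
  -- the alternation index `k = a` in `Fin B`; `k.castSucc = a` and `k.succ = a + 1 =: c`
  obtain ⟨k, hk⟩ : ∃ k : Fin B, (k : ℕ) = (a : ℕ) := ⟨⟨a, haB⟩, rfl⟩
  have hka : k.castSucc = a := Fin.ext (by rw [Fin.val_castSucc]; exact hk)
  have hkc : ((k.succ : Fin (B + 1)) : ℕ) = (a : ℕ) + 1 := by rw [Fin.val_succ, hk]
  by_cases hpc : p k.succ = p a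
  · -- adjacent repetition contradicts the sign alternation at `k`
    have h := halt k
    rw [hka, hpc] at h
    exact hsq h
  · -- otherwise `a < k.succ < b`
    have hcb : k.succ < b := by
      refine Fin.lt_def.2 ?_
      rw [hkc]
      rcases Nat.lt_or_ge ((a : ℕ) + 1) b with h | h
      · exact h
      · exfalso
        have hbe : b = k.succ := Fin.ext (by rw [hkc]; omega)
        rw [hbe] at hpab
        exact hpc hpab.symm
    have hac : a < k.succ := Fin.lt_def.2 (by rw [hkc]; exact Nat.lt_succ_self _)
    have hpcb : p k.succ ≠ p b := fun h => hpc (h.trans hpab.symm)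
    -- `p a` beats `p k.succ` at `θ a` and (as `p b = p a`) at `θ b` ...
    have h1 : tropWeight d v (θ a) (p k.succ) < tropWeight d v (θ a) (p a) :=
      (hdom a).2 (p k.succ) hpc (hdom k.succ).1
    have h2 : tropWeight d v (θ b) (p k.succ) < tropWeight d v (θ b) (p a) := by
      have h := (hdom b).2 (p k.succ) hpcb (hdom k.succ).1
      rwa [← hpab] at h
    -- ... hence at `θ k.succ`, where however `p k.succ` is the unique optimum
    have h3 : tropWeight d v (θ k.succ) (p a) < tropWeight d v (θ k.succ) (p k.succ) :=
      (hdom k.succ).2 (p a) (Ne.symm hpc) (hdom a).1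
    have h4 : tropWeight d v (θ k.succ) (p k.succ) < tropWeight d v (θ k.succ) (p a) :=
      tropWeight_lt_between d v (p a) (p k.succ) (hθ hac).le (hθ hcb).le h1 h2
    exact lt_asymm h3 h4

end StubDominantInjective

/-- **Registered stub `stub_dominantInjective`** (dominant terms at increasing slopes with
alternating signs are pairwise distinct): adjacent ones differ because their signs do; non-adjacent
ones because the set of slopes at which a fixed term is the unique optimum is an interval (tropical
weights are affine in `θ`), which would swallow the term in between. -/
theorem stub_dominantInjective (m K : ℕ) (d : Fin K → ℕ) (v ε : Fin m → Fin m → Fin K → ℤ) (B : ℕ)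
    (θ : Fin (B + 1) → ℤ) (p : Fin (B + 1) → Equiv.Perm (Fin m) × (Fin m → Fin K))
    (hθ : StrictMono θ) (hdom : ∀ k, IsDominant d v ε (θ k) (p k))
    (halt : ∀ k : Fin B, termSign ε (p k.castSucc) * termSign ε (p k.succ) < 0) :
    Function.Injective p := by
  intro a b hpab
  rcases lt_trichotomy a b with h | h | h
  · exact absurd hpab (StubDominantInjective.apart d v ε θ p hθ hdom halt h)
  · exact h
  · exact absurd hpab.symm (StubDominantInjective.apart d v ε θ p hθ hdom halt h)

end Summit.ValiantsHypothesis.ValiantsHypothesis.Theorems.LacunarySymmetroidMatrixDescartes
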